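import Mathlib
import Summits.AtomisticToContinuum.BoseEinsteinCondensation.Theses.BECHardSphereReduction
import Summits.AtomisticToContinuum.BoseEinsteinCondensation.Theorems.BECConjugateDominationHardCoreExtensionClosureMap
import Summits.AtomisticToContinuum.BoseEinsteinCondensation.Theorems.BECHardSphereReductionZeroModeGlue
import Summits.AtomisticToContinuum.BoseEinsteinCondensation.Theorems.BECHardSphereReductionHardSphereScaling

/-!
# Crux-strategist census sketch r1 for `HardSphereBEC` (stmt-AtomisticToContinuum-11885)

Typed versions of the statements quoted in `STRATEGY-CENSUS-r1.md` (second-opinion census,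
seat `cstrat-…-11885-r1`). Nothing here is filed as an item or registered as a line; the file only
certifies that the signatures discussed in the census elaborate over the tree's declarations.
The first census' sketch is `StrategyCensusSketch.lean` (seat s1); the statements below are the
ones of the r1 inventory that s1 does not contain (KLS-shape split for hard spheres, finite-mode
confinement, and the fragmentation witness that kills energy-only lines).
-/

noncomputable section

namespace Summit.AtomisticToContinuum.BoseEinsteinCondensation.Cruxes.HardSphereBEC.StrategistCensusR1

open Filter MeasureTheory
open scoped ENNReal
open Literature.MathematicalPhysics.QuantumManyBody.BoseGas

/-- The unit hard-sphere pair potential `v = ⊤·1_{r ≤ 1}` (scattering length `a = 1`). -/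
def HS₁ : ℝ → ℝ≥0∞ := Set.indicator (Set.Iic 1) (fun _ : ℝ => (⊤ : ℝ≥0∞))

/-- The crux, by name. -/
abbrev Crux : Prop :=
  Summit.AtomisticToContinuum.BoseEinsteinCondensation.Theses.BECHardSphereReduction.HardSphereBEC

/-- The inner box `Λ' = (εL, L − εL)³`. -/
def innerBox (ε L : ℝ) : Set Space :=
  {x | ∀ j, x j ∈ Set.Ioo (ε * L) (L - ε * L)}

/-- The inner-box plane wave `φ'_k = L'^{-3/2} e^{2πi k·x/L'} 1_{Λ'}`, `L' = (1 − 2ε)L`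
(spelling of route `BECInfraredBound`). -/
def innerPlaneWave (ε L : ℝ) (k : Fin 3 → ℤ) : Space → ℂ :=
  (innerBox ε L).indicator fun x =>
    ((Real.sqrt (((1 - 2 * ε) * L) ^ 3))⁻¹ : ℂ) *
      Complex.exp (Complex.I * ↑(2 * Real.pi / ((1 - 2 * ε) * L) * ∑ j, (k j : ℝ) * x j))

/-! ## Strengthen / Decomposition piece D₁ — the KLS-shape infrared bound for hard spheres -/

/-- **S⁺_IR = D₁ (`IrWindowHS`): T = 0 infrared bound, window form, unit hard spheres.** For every
`ε ∈ (0,1/4)` and `K > 0` there are `η₀, C > 0` such that for `0 < η < η₀`, all large `N`, some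
`δ > 0` and every `δ`-near-minimiser `Ψ` of the hard-sphere Dirichlet energy in the box of side
`L = (N/η)^{1/3}`: every inner plane wave with `0 < ‖k‖ ≤ K√η·L` has occupation
`≤ C(1 + √η·L/‖k‖)`. The hard-sphere instance of `BECInfraredBound.BecIrWindow`
(stmt-AtomisticToContinuum-8911); continuum analogue of Gaussian domination / the KLS infrared bound. -/
def IrWindowHS : Prop :=
  ∀ ε : ℝ, 0 < ε → ε < 1 / 4 → ∀ K : ℝ, 0 < K → ∃ η₀ : ℝ, 0 < η₀ ∧ ∃ C : ℝ, 0 < C ∧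
    ∀ η : ℝ, 0 < η → η < η₀ → ∀ᶠ N : ℕ in atTop, ∃ δ : ℝ≥0∞, 0 < δ ∧
      ∀ Ψ : TrialState N (sideLength η N),
        energy HS₁ Ψ ≤ groundStateEnergy HS₁ N (sideLength η N) + δ →
        ∀ k : Fin 3 → ℤ, k ≠ 0 → ‖(fun j => (k j : ℝ))‖ ≤ K * Real.sqrt η * sideLength η N →
          occupation N (innerPlaneWave ε (sideLength η N) k) Ψ.ψ ≤
            ENNReal.ofReal (C * (1 + Real.sqrt η * sideLength η N / ‖(fun j => (k j : ℝ))‖))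

/-! ## Decomposition pieces D₂, D₃ (the "routine" halves of the KLS split) -/

/-- **D₂ (`UvTailHS`): summed ultraviolet tail.** Some `K > 0`, `θ < 1`: for every `ε ∈ (0,1/4)`,
small `η`, large `N`, near-minimisers have at most `θN` particles in inner plane waves with
`‖k‖ > K√η·L`. Hard-sphere instance of `BECInfraredBound.BecUvTail` (stmt-8823). -/
def UvTailHS : Prop :=
  ∃ K : ℝ, 0 < K ∧ ∃ θ : ℝ, θ < 1 ∧ ∀ ε : ℝ, 0 < ε → ε < 1 / 4 → ∃ η₀ : ℝ, 0 < η₀ ∧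
    ∀ η : ℝ, 0 < η → η < η₀ → ∀ᶠ N : ℕ in atTop, ∃ δ : ℝ≥0∞, 0 < δ ∧
      ∀ Ψ : TrialState N (sideLength η N),
        energy HS₁ Ψ ≤ groundStateEnergy HS₁ N (sideLength η N) + δ →
        ∑' k : {k : Fin 3 → ℤ // K * Real.sqrt η * sideLength η N < ‖(fun j => (k j : ℝ))‖},
            occupation N (innerPlaneWave ε (sideLength η N) (k : Fin 3 → ℤ)) Ψ.ψ ≤
          ENNReal.ofReal (θ * N)

/-- **D₃ (`ShellMassHS`): no boundary accumulation.** Near-minimisers put at most `CεN` particles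
in the shell `Λ ∖ Λ'`. Hard-sphere instance of `BECInfraredBound.BecShellMass` (stmt-0734). -/
def ShellMassHS : Prop :=
  ∃ C : ℝ, 0 < C ∧ ∀ ε : ℝ, 0 < ε → ε < 1 / 4 → ∃ η₀ : ℝ, 0 < η₀ ∧
    ∀ η : ℝ, 0 < η → η < η₀ → ∀ᶠ N : ℕ in atTop, ∃ δ : ℝ≥0∞, 0 < δ ∧
      ∀ Ψ : TrialState N (sideLength η N),
        energy HS₁ Ψ ≤ groundStateEnergy HS₁ N (sideLength η N) + δ →
        ∑ i : Fin N, ∫⁻ X, (innerBox ε (sideLength η N))ᶜ.indicator (fun _ => (1 : ℝ≥0∞)) (X i) *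
            (‖Ψ.ψ X‖₊ : ℝ≥0∞) ^ 2 ≤ ENNReal.ofReal (C * ε * N)

/-- **Shape of the split's assembly** (NOT proved here; the census explains why it is not filed):
`D₁ → D₂ → D₃ → HardSphereZeroMode` by Parseval on `Λ'`, lattice-point counting in the window
(pattern of `becWindowCount_proof`) and the shell transfer `φ₀ = (1−2ε)^{3/2} φ'_0 + w`; then
`HardSphereZeroMode → Crux` is the landed `hardSphereBEC_of_zeroMode_of_scaling` with
`hardSphereScaling_proof`. -/
def KLSSplitAssemblyShape : Prop :=
  IrWindowHS → UvTailHS → ShellMassHS →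
    Summit.AtomisticToContinuum.BoseEinsteinCondensation.Theses.BECHardSphereReduction.HardSphereZeroMode

/-! ## Strengthen S⁺_M — finite-mode confinement -/

/-- **S⁺_M (`FiniteModeConfinementHS`).** At small density the near-minimisers keep a fraction
`1 − θ > 0` of the particles in a FIXED number `M(η)` of one-body modes (orthonormal, measurable),
uniformly in `N`. Implies the crux with `c = (1 − θ)/M` (pigeonhole on the `M` occupations, each
`≤ λ_max`). The census shows it is not easier: energy near-minimality cannot confine particles to
`M = O(1)` modes (fragmentation witness below), and no non-energetic confinement tool is known. -/
def FiniteModeConfinementHS : Prop :=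
  ∃ θ : ℝ, θ < 1 ∧ ∃ η₁ : ℝ, 0 < η₁ ∧ ∀ η : ℝ, 0 < η → η < η₁ → ∃ M : ℕ, 0 < M ∧
    ∀ᶠ N : ℕ in atTop, ∃ δ : ℝ≥0∞, 0 < δ ∧ ∀ Ψ : TrialState N (sideLength η N),
      energy HS₁ Ψ ≤ groundStateEnergy HS₁ N (sideLength η N) + δ →
      ∃ u : Fin M → (Space → ℂ),
        (∀ m, AEStronglyMeasurable (u m) volume ∧ ∫⁻ x, (‖u m x‖₊ : ℝ≥0∞) ^ 2 = 1) ∧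
        (∀ m m', m ≠ m' → ∫ x, (starRingEnd ℂ) (u m x) * u m' x = 0) ∧
        ENNReal.ofReal ((1 - θ) * N) ≤ ∑ m, occupation N (u m) Ψ.ψ

/-! ## Negation side — the fragmentation witness (obstruction, not a counterexample) -/

/-- **N₁ (`FragmentationWitnessHS`): leading-order energy near-minimality is blind to condensation.**
For every small density `η` there are `K, C` such that for all large `N` the hard-sphere Dirichlet
box of side `(N/η)^{1/3}` carries a NON-NEGATIVE symmetric trial state with energy within the
factor `1 + C η^{1/3}` of the dilute-limit value `4πηN` (so within `O(η^{1/3})` relative of `E₀`)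
whose one-particle density matrix has ALL eigenvalues `≤ K` (no condensation at all, uniformly in
`N`). Construction: tile the box by Dirichlet cubes of a fixed side `ℓ(η) ≫ η^{-1/2}` (healing
length), put `ηℓ³` spheres in each in its tapered ground / Dyson state, symmetrise; energy per
particle by `eventually_groundStateEnergy_le_dyson` read at fixed particle number `ηℓ³`,
`λ_max ≤ ηℓ³ =: K` by Bessel over the disjointly supported cube modes. This is what every line
driven by an energy inequality of extensive resolution must fail to exclude; it is NOT a
`δ`-near-minimiser for the `δ → 0` of `condensateNumber` (the crux is untouched). -/
def FragmentationWitnessHS : Prop :=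
  ∃ η₀ : ℝ, 0 < η₀ ∧ ∀ η : ℝ, 0 < η → η < η₀ → ∃ K C : ℝ, 0 < K ∧ 0 < C ∧
    ∀ᶠ N : ℕ in atTop, ∃ Ψ : TrialState N (sideLength η N),
      (∀ X, Ψ.ψ X = (‖Ψ.ψ X‖ : ℂ)) ∧
      energy HS₁ Ψ ≤ ENNReal.ofReal (4 * Real.pi * η * (1 + C * η ^ (1 / 3 : ℝ)) * N) ∧
      maxOccupation N Ψ.ψ ≤ ENNReal.ofReal K

/-- Sanity edge: the crux is a consequence of the sub-problem (in tree, unconditionally). -/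
example (hB : _root_.BoseEinsteinCondensation) : Crux :=
  Summit.AtomisticToContinuum.BoseEinsteinCondensation.Cruxes.HardCoreExtension.ClosureMap.hardSphereBEC_of_conjunct hB

/-- Sanity edge: the last arrow of the KLS split is landed (`HardSphereZeroMode → Crux`). -/
example
    (hZ : Summit.AtomisticToContinuum.BoseEinsteinCondensation.Theses.BECHardSphereReduction.HardSphereZeroMode) :
    Crux :=
  Summit.AtomisticToContinuum.BoseEinsteinCondensation.Theorems.hardSphereBEC_of_zeroMode_of_scaling hZ
    Summit.AtomisticToContinuum.BoseEinsteinCondensation.Theorems.hardSphereScaling_proof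

/-- Sanity edge: `FiniteModeConfinementHS`-type pigeonhole is the only step from `M` modes to
`λ_max ≥ (1−θ)N/M`; recorded informally in the census (not needed by any edge here). -/
example : True := trivial

end Summit.AtomisticToContinuum.BoseEinsteinCondensation.Cruxes.HardSphereBEC.StrategistCensusR1
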